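import Mathlib
import Summits.NavierStokesRegularity.NavierStokesRegularity.Theorems.EulerZoomLiouvillePowerGaugeEulerLiouvilleShellLawTools
import Summits.NavierStokesRegularity.NavierStokesRegularity.Theorems.EulerZoomLiouvillePowerGaugeEulerLiouvilleBallMeanValueFormula

/-!
# R49 plate t52-TS: the TWO-SPHERE LAW (nsreg-p2 ROUND-49 «EVERY BALL BREATHES», `NsregP2.R49.TwoSphereLaw`, text VERBATIM from
# `r49/Sketch49.lean` l.165–175; seat ns-ezl-w2 g6, `--supports stmt-NavierStokesRegularity-19832 --as helper`)

Chae–Wolf (2.8) with `α = 3`, for `γ`-profiles about EVERY centre `x₀` (γ-free): with `m(r) = ⟨V_n² + P⟩_{∂B_r(x₀)}` and `Sᵢ` the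
`r`-derivatives of `r ↦ ∫_{B_r(x₀)}(V_n² + P)` at `r₁ < r₂`,
`S₁/(4πr₁²) − S₂/(4πr₂²) = (1/4π) ∫_{B_{r₂}(x₀)∖B_{r₁}(x₀)} (3V_n² − ‖V‖²)‖z‖⁻³ dy` — the pressure drops out of the shell term exactly at
`α = 3`.  Proof: the α-family engine `shellLaw_of_meanValue` (`…ShellLawTools`) at `α = 3` for the pair `(V, P)` (tent mean-value formula
= ns-sfl-p1 g8's `meanValueFormula`), and the identification `Sᵢ = rᵢ²·sphereIntegral(V_n² + P)(rᵢ)` by uniqueness of derivatives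
(polar coordinates + FTC: `r ↦ ∫_{B_r(x₀)}(V_n² + P)` has derivative `δ²·sphereIntegral(V_n² + P)(δ)`).

HONEST FRAMING: a ROUND-49 instrument identity (class-free); nothing about the crux E (19832 OPEN) or NS regularity.
[cite: ChaeWolf2016, Remark 2.3 (2.8)] [folklore]
-/

noncomputable section

set_option linter.dupNamespace false

open MeasureTheory Set Filter Topology Metric Function TopologicalSpace
open scoped ENNReal NNReal RealInnerProductSpace Topology

namespace Summit.NavierStokesRegularity.NavierStokesRegularity.Theorems.PowerGaugeEulerLiouville

open Literature.Analysis Literature.Analysis.FunctionSpaces Literature.Analysis.FluidPDE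

namespace ClassicalProfile

/-- `⟪w, z⟫²/‖z‖² ≤ ‖w‖²` (Cauchy–Schwarz; the left side is `0` at `z = 0`). [folklore] -/
private theorem inner_sq_div_norm_sq_le_aux (w z : EuclideanSpace ℝ (Fin 3)) : ⟪w, z⟫ ^ 2 / ‖z‖ ^ 2 ≤ ‖w‖ ^ 2 := by
  by_cases hz : z = 0
  · simp [hz]
  · rw [div_le_iff₀ (by positivity)]
    have h := abs_real_inner_le_norm w z
    have h0 : 0 ≤ |⟪w, z⟫| := abs_nonneg _
    nlinarith [sq_abs ⟪w, z⟫, norm_nonneg w, norm_nonneg z, mul_nonneg (norm_nonneg w) (norm_nonneg z)]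

/-- The normal-energy density `⟪U, z⟫²/‖z‖²` plus a continuous `Q` is integrable on every ball (local copy; the public version is
ns-sfl-p1 g8's `integrableOn_ball_normalSq_add`). [folklore] -/
private theorem integrableOn_ball_normalSq_add_aux {U : EuclideanSpace ℝ (Fin 3) → EuclideanSpace ℝ (Fin 3)}
    {Q : EuclideanSpace ℝ (Fin 3) → ℝ} (hU : Continuous U) (hQ : Continuous Q) (x₀ : EuclideanSpace ℝ (Fin 3)) (ρ : ℝ) :
    IntegrableOn (fun y => ⟪U y, y - x₀⟫ ^ 2 / ‖y - x₀‖ ^ 2 + Q y) (ball x₀ ρ) := by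
  have hcn : Continuous fun y : EuclideanSpace ℝ (Fin 3) => ‖y - x₀‖ := continuous_norm.comp (continuous_sub_right x₀)
  have hc : Continuous fun y => ‖U y‖ ^ 2 + |Q y| := by fun_prop
  have hci : Continuous fun y : EuclideanSpace ℝ (Fin 3) => ⟪U y, y - x₀⟫ := hU.inner (continuous_id.sub continuous_const)
  refine Integrable.mono' ((hc.continuousOn.integrableOn_compact (isCompact_closedBall x₀ ρ)).mono_set ball_subset_closedBall)
    ((((hci.measurable.pow_const 2).div (hcn.measurable.pow_const 2)).add hQ.measurable).aestronglyMeasurable)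
    (ae_of_all _ fun y => ?_)
  rw [Real.norm_eq_abs]
  calc |⟪U y, y - x₀⟫ ^ 2 / ‖y - x₀‖ ^ 2 + Q y| ≤ |⟪U y, y - x₀⟫ ^ 2 / ‖y - x₀‖ ^ 2| + |Q y| := abs_add_le _ _
    _ ≤ ‖U y‖ ^ 2 + |Q y| := by
        rw [abs_of_nonneg (div_nonneg (sq_nonneg _) (sq_nonneg _))]
        exact add_le_add (inner_sq_div_norm_sq_le_aux (U y) (y - x₀)) le_rfl

/-- **The ball integral of `U_n² + Q` is differentiable in the radius** with derivative `δ²·sphereIntegral(U_n² + Q)(δ)` at `δ > 0`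
(polar coordinates about `x₀` + FTC; local copy — the public version is ns-sfl-p1 g8's `hasDerivAt_integral_ball_normalSq_add`). [folklore] -/
private theorem hasDerivAt_integral_ball_normalSq_add_aux {U : EuclideanSpace ℝ (Fin 3) → EuclideanSpace ℝ (Fin 3)}
    {Q : EuclideanSpace ℝ (Fin 3) → ℝ} (hU : Continuous U) (hQ : Continuous Q) (x₀ : EuclideanSpace ℝ (Fin 3)) {δ : ℝ}
    (hδ : 0 < δ) :
    HasDerivAt (fun r => ∫ y in ball x₀ r, (⟪U y, y - x₀⟫ ^ 2 / ‖y - x₀‖ ^ 2 + Q y))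
      (δ ^ 2 * sphereIntegral volume
        (fun z : EuclideanSpace ℝ (Fin 3) => ⟪U (z + x₀), z⟫ ^ 2 / ‖z‖ ^ 2 + Q (z + x₀)) δ) δ := by
  set S : ℝ → ℝ := fun r => ∫ α : sphere (0 : EuclideanSpace ℝ (Fin 3)) 1,
      (⟪U (r • (α : EuclideanSpace ℝ (Fin 3)) + x₀), (α : EuclideanSpace ℝ (Fin 3))⟫ ^ 2 +
        Q (r • (α : EuclideanSpace ℝ (Fin 3)) + x₀))
        ∂(volume : Measure (EuclideanSpace ℝ (Fin 3))).toSphere with hS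
  have hSc : Continuous S := continuous_radialNormalDensity hU hQ x₀
  have hpolar : ∀ ρ : ℝ, 0 < ρ →
      ∫ y in ball x₀ ρ, (⟪U y, y - x₀⟫ ^ 2 / ‖y - x₀‖ ^ 2 + Q y) = ∫ r in (0 : ℝ)..ρ, r ^ 2 * S r := by
    intro ρ hρ
    rw [setIntegral_ball_eq_intervalIntegral_sphereIntegral (integrableOn_ball_normalSq_add_aux hU hQ x₀ ρ) hρ.le]
    refine intervalIntegral.integral_congr_ae (ae_of_all _ fun r hr => ?_)
    rw [uIoc_of_le hρ.le] at hr
    have e : (fun z : EuclideanSpace ℝ (Fin 3) => ⟪U (z + x₀), z + x₀ - x₀⟫ ^ 2 / ‖z + x₀ - x₀‖ ^ 2 + Q (z + x₀)) =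
        fun z => ⟪U (z + x₀), z⟫ ^ 2 / ‖z‖ ^ 2 + Q (z + x₀) := by
      funext z; simp only [add_sub_cancel_right]
    rw [e, sphereIntegral_normalSq_eq x₀ hr.1]
  have hΦ : HasDerivAt (fun ρ : ℝ => ∫ r in (0 : ℝ)..ρ, r ^ 2 * S r) (δ ^ 2 * S δ) δ :=
    (((continuous_pow 2).mul hSc).integral_hasStrictDerivAt 0 δ).hasDerivAt
  have heq : (fun ρ : ℝ => ∫ r in (0 : ℝ)..ρ, r ^ 2 * S r) =ᶠ[𝓝 δ]
      fun r => ∫ y in ball x₀ r, (⟪U y, y - x₀⟫ ^ 2 / ‖y - x₀‖ ^ 2 + Q y) := by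
    filter_upwards [Ioi_mem_nhds hδ] with ρ hρ
    rw [hpolar ρ hρ]
  have h := hΦ.congr_of_eventuallyEq heq.symm
  rw [sphereIntegral_normalSq_eq x₀ hδ]
  exact h

/-- **TWO-SPHERE LAW** (`NsregP2.R49.TwoSphereLaw γ`, text verbatim): Chae–Wolf (2.8) with `α = 3` for `γ`-profiles about every centre;
see the module docstring. [cite: ChaeWolf2016, Remark 2.3 (2.8)] [folklore] -/
theorem twoSphereLaw (γ : ℝ) :
    ∀ (c : EuclideanSpace ℝ (Fin 3)) (V : EuclideanSpace ℝ (Fin 3) → EuclideanSpace ℝ (Fin 3)) (P : EuclideanSpace ℝ (Fin 3) → ℝ),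
      IsSelfSimilarEulerProfile γ c V P →
      ∀ (x₀ : EuclideanSpace ℝ (Fin 3)) (r₁ r₂ S₁ S₂ : ℝ), 0 < r₁ → r₁ < r₂ →
        HasDerivAt (fun r => ∫ y in ball x₀ r, (⟪V y, y - x₀⟫ ^ 2 / ‖y - x₀‖ ^ 2 + P y)) S₁ r₁ →
        HasDerivAt (fun r => ∫ y in ball x₀ r, (⟪V y, y - x₀⟫ ^ 2 / ‖y - x₀‖ ^ 2 + P y)) S₂ r₂ →
          S₁ / (4 * Real.pi * r₁ ^ 2) - S₂ / (4 * Real.pi * r₂ ^ 2)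
            = 1 / (4 * Real.pi) * ∫ y in ball x₀ r₂ \ ball x₀ r₁,
                (3 * ⟪V y, y - x₀⟫ ^ 2 / ‖y - x₀‖ ^ 2 - ‖V y‖ ^ 2) / ‖y - x₀‖ ^ 3 := by
  intro c V P hprof x₀ r₁ r₂ S₁ S₂ hr₁ h12 hS₁ hS₂
  have hr₂ : 0 < r₂ := hr₁.trans h12
  have hV : Continuous V := hprof.contDiff_velocity.continuous
  have hP : Continuous P := hprof.contDiff_pressure.continuous
  -- the derivatives are `rᵢ² · sphereIntegral(V_n² + P)(rᵢ)`
  have e1 := hS₁.unique (hasDerivAt_integral_ball_normalSq_add_aux hV hP x₀ hr₁)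
  have e2 := hS₂.unique (hasDerivAt_integral_ball_normalSq_add_aux hV hP x₀ hr₂)
  -- the shell law at `α = 3` for the pair `(V, P)`
  have hMV : ∀ ρ : ℝ, 0 < ρ → ∫ y in ball x₀ ρ, (⟪V y, y - x₀⟫ ^ 2 / ‖y - x₀‖ + ‖y - x₀‖ * P y)
      = ∫ y in ball x₀ ρ, (ρ - ‖y - x₀‖) * (‖V y‖ ^ 2 + 3 * P y) := fun ρ hρ => meanValueFormula γ c V P hprof x₀ ρ hρ
  have hshell := shellLaw_of_meanValue hV hP x₀ hMV 3 hr₁ h12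
  have h3 : (3 : ℝ) - 3 = 0 := by norm_num
  rw [h3, Real.rpow_zero, Real.rpow_zero, one_mul, one_mul] at hshell
  -- the integrand at `α = 3`
  have hint : ∫ y in ball x₀ r₂ \ ball x₀ r₁, ‖y - x₀‖ ^ (-(3 : ℝ)) *
        (‖V y‖ ^ 2 - 3 * (⟪V y, y - x₀⟫ ^ 2 / ‖y - x₀‖ ^ 2) + 0 * P y)
      = -∫ y in ball x₀ r₂ \ ball x₀ r₁, (3 * ⟪V y, y - x₀⟫ ^ 2 / ‖y - x₀‖ ^ 2 - ‖V y‖ ^ 2) / ‖y - x₀‖ ^ 3 := by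
    rw [← integral_neg]
    refine integral_congr_ae (ae_of_all _ fun y => ?_)
    beta_reduce
    have hp : ‖y - x₀‖ ^ (-(3 : ℝ)) = (‖y - x₀‖ ^ 3)⁻¹ := by
      rw [Real.rpow_neg (norm_nonneg _), show (3 : ℝ) = ((3 : ℕ) : ℝ) by norm_num, Real.rpow_natCast]
    rw [hp]
    ring
  rw [hint] at hshell
  rw [e1, e2]
  have hπ : Real.pi ≠ 0 := Real.pi_ne_zero
  field_simp
  linear_combination (-1 : ℝ) * hshell


/-! ## The γ-free α-family (Chae–Wolf (2.8) VERBATIM for `γ`-profiles, every real `α`, every centre) -/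

/-- **THE `‖x − x₀‖^{−α}` FAMILY FOR `γ`-PROFILES** (Chae–Wolf, Remark 2.3 (2.8), "for all `0 < r < R` and `α ∈ ℝ`", γ-free by the gradient-test
dictionary, about EVERY centre `x₀`): for a `γ`-profile `(V, P)` and `0 < r₁ < r₂`,
`r₂^{3−α}·sphereIntegral(V_n² + P)(r₂) − r₁^{3−α}·sphereIntegral(V_n² + P)(r₁) = ∫_{B_{r₂}(x₀)∖B_{r₁}(x₀)} ‖z‖^{−α}(‖V‖² − αV_n² + (3−α)P) dy`
(`= 4π[r^{3−α}m(r)]_{r₁}^{r₂}` with the sphere MEAN `m`).  One line over the engine `shellLaw_of_meanValue` and ns-sfl-p1 g8's `meanValueFormula`.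
[cite: ChaeWolf2016, Remark 2.3 (2.8)] [folklore] -/
theorem shellLaw (γ α : ℝ) {c : EuclideanSpace ℝ (Fin 3)} {V : EuclideanSpace ℝ (Fin 3) → EuclideanSpace ℝ (Fin 3)}
    {P : EuclideanSpace ℝ (Fin 3) → ℝ} (hprof : IsSelfSimilarEulerProfile γ c V P) (x₀ : EuclideanSpace ℝ (Fin 3)) {r₁ r₂ : ℝ}
    (hr₁ : 0 < r₁) (h12 : r₁ < r₂) :
    r₂ ^ (3 - α) * sphereIntegral volume
          (fun z : EuclideanSpace ℝ (Fin 3) => ⟪V (z + x₀), z⟫ ^ 2 / ‖z‖ ^ 2 + P (z + x₀)) r₂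
      - r₁ ^ (3 - α) * sphereIntegral volume
          (fun z : EuclideanSpace ℝ (Fin 3) => ⟪V (z + x₀), z⟫ ^ 2 / ‖z‖ ^ 2 + P (z + x₀)) r₁
      = ∫ y in ball x₀ r₂ \ ball x₀ r₁, ‖y - x₀‖ ^ (-α) *
          (‖V y‖ ^ 2 - α * (⟪V y, y - x₀⟫ ^ 2 / ‖y - x₀‖ ^ 2) + (3 - α) * P y) :=
  shellLaw_of_meanValue hprof.contDiff_velocity.continuous hprof.contDiff_pressure.continuous x₀
    (fun ρ hρ => meanValueFormula γ c V P hprof x₀ ρ hρ) α hr₁ h12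

/-- **The γ-free α-family, differential form**: for a `γ`-profile, every centre `x₀`, every real `α` and `r > 0`,
`d/dr[r^{3−α}·sphereIntegral(V_n² + P)(r)] = r^{2−α}·sphereIntegral(‖V‖² − αV_n² + (3−α)P)(r)` — at `α = 3` (means):
`d/dδ⟨V_n² + P⟩_{∂B_δ(x₀)} = δ⁻¹⟨‖V_T‖² − 2V_n²⟩_{∂B_δ(x₀)}` (no polynomial in the V-form). [cite: ChaeWolf2016, Remark 2.3 (2.8)] [folklore] -/
theorem shellLawDeriv (γ α : ℝ) {c : EuclideanSpace ℝ (Fin 3)} {V : EuclideanSpace ℝ (Fin 3) → EuclideanSpace ℝ (Fin 3)}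
    {P : EuclideanSpace ℝ (Fin 3) → ℝ} (hprof : IsSelfSimilarEulerProfile γ c V P) (x₀ : EuclideanSpace ℝ (Fin 3)) {r : ℝ}
    (hr : 0 < r) :
    HasDerivAt (fun t : ℝ => t ^ (3 - α) * sphereIntegral volume
        (fun z : EuclideanSpace ℝ (Fin 3) => ⟪V (z + x₀), z⟫ ^ 2 / ‖z‖ ^ 2 + P (z + x₀)) t)
      (r ^ (2 - α) * sphereIntegral volume (fun z : EuclideanSpace ℝ (Fin 3) =>
        ‖V (z + x₀)‖ ^ 2 - α * (⟪V (z + x₀), z⟫ ^ 2 / ‖z‖ ^ 2) + (3 - α) * P (z + x₀)) r) r :=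
  hasDerivAt_rpow_mul_sphereIntegral_of_meanValue hprof.contDiff_velocity.continuous hprof.contDiff_pressure.continuous x₀
    (fun ρ hρ => meanValueFormula γ c V P hprof x₀ ρ hρ) α hr

end ClassicalProfile

end Summit.NavierStokesRegularity.NavierStokesRegularity.Theorems.PowerGaugeEulerLiouville

end
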